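import Literature.Topology.FourManifolds.LeeRasmussenRankProofs
import Literature.Topology.FourManifolds.KhComplexDSquaredProofs
import HarnessLib

/-!
# Lee's theorem in degree zero: discharge of `finrank_leeHomologyZero_eq_two`

Sibling proof file of `LeeRasmussen.lean` and `LeeRasmussenRankProofs.lean` (topic
`Literature/Topology/FourManifolds`; D-0014: a named fact `def X : Prop` is discharged as
`theorem X_holds : X`). It closes the named fact
`Literature.Topology.FourManifolds.GaussDiagram.finrank_leeHomologyZero_eq_two` — **for a Gauss
diagram realised by a knot, Lee homology in homological degree `0` is two-dimensional over `ℚ`**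
(E. S. Lee, *An endomorphism of the Khovanov invariant*, Adv. Math. 197 (2005), Thm. 4.2;
Rasmussen (2010), §2.3) — by composing two results already in the tree:

* `LeeRasmussenRankProofs.finrank_leeHomologyZero_eq_two_of_dichotomy` — all the algebra: Lee's
  change of basis, the label decomposition, the contraction off the two canonical generators,
  `d² = 0` from the merge/split dichotomy;
* `KhComplexDSquaredProofs.isMergeAt_or_isSplitAt_of_hasGaussDiagram_holds` — the merge/split
  dichotomy for realisable diagrams (Gauss's parity condition for regular projections of knots,
  `RegularProjectionParity`; parity ⇒ dichotomy, `KhResolutionsDichotomyProofs`), the only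
  place where planarity enters.

No definition and no named fact is introduced.

## References

* E. S. Lee, *An endomorphism of the Khovanov invariant*, Adv. Math. 197 (2005) 554–586,
  Thm. 4.2 (`Kh'` of an `n`-component link has rank `2ⁿ`; for a knot it is `ℚ ⊕ ℚ` in
  degree `0`). [cite: Lee2005, Thm. 4.2]
* J. Rasmussen, *Khovanov homology and the slice genus*, Invent. Math. 182 (2010) 419–447
  (arXiv:math/0402131), §2.3 (canonical generators), Prop. 2.3. [cite: Rasmussen2010, §2.3]
-/

noncomputable section

namespace Literature.Topology.FourManifolds

namespace GaussDiagram

/-- **Lee's theorem, degree zero (discharge of the named fact `finrank_leeHomologyZero_eq_two`).**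
For every Gauss diagram `G` realised by a knot, `dim_ℚ Kh'⁰(G) = 2`. The merge/split dichotomy
for realisable diagrams is `isMergeAt_or_isSplitAt_of_hasGaussDiagram_holds`; the algebra is
`finrank_leeHomologyZero_eq_two_of_dichotomy`. Lee (2005), Thm. 4.2; Rasmussen (2010), §2.3.
[cite: Lee2005, Thm. 4.2] -/
theorem finrank_leeHomologyZero_eq_two_holds : finrank_leeHomologyZero_eq_two :=
  finrank_leeHomologyZero_eq_two_of_dichotomy fun G ↦ @isMergeAt_or_isSplitAt_of_hasGaussDiagram_holds G

end GaussDiagram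

end Literature.Topology.FourManifolds
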